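import Mathlib
import Summits.ValiantsHypothesis.ValiantsHypothesis.Theses.LiouvilleSarnak

/-!
# Route LiouvilleSarnak — crux `DigitalBilinearLiouville` (stmt-ValiantsHypothesis-14774), line `tt_star`:
# the pair-correlation sum of the open stub is the SAME over row pairs and over column pairs

The open stub `tt_star.stub_twoPointDigital` asks, for every balanced cut `π` at every large level `n`, that the
ROW-pair correlation sum `G_π = Σ_{r,r'} ‖Σ_c M_π(r,c) M_π(r',c)‖²` of the Liouville cut matrix
`M_π(r,c) = λ(N_π(r,c)+1)` be `≤ ε 16^n`.  This file records the elementary identity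

* `gram_rows_eq_gram_cols` — for ANY integer matrix `B : ι × κ`:
  `Σ_{r,r'} (Σ_c B_rc B_r'c)² = Σ_{c,c'} (Σ_r B_rc B_rc')²` (both are the four-fold sum
  `Σ_{r,r',c,c'} B_rc B_r'c B_rc' B_r'c'`; for real matrices this is `‖B Bᵀ‖_F² = ‖Bᵀ B‖_F²`, here without
  any spectral language), and its instance
* ★ `twoPoint_rows_eq_cols` — for EVERY cut `π` at EVERY level `n`:
  `Σ_{r,r'} ‖Σ_c M_π(r,c) M_π(r',c)‖² = Σ_{c,c'} ‖Σ_r M_π(r,c) M_π(r,c')‖²`,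
  so `stub_twoPointDigital` may be attacked in either currency (`twoPointDigital_iff_cols`): e.g. for the ALIGNED cut
  (`N = 2^n r + c`) the row form is a mean-square two-point correlation of `λ` inside the intervals
  `(2^n r, 2^n (r+1)]` over shifts `d ∈ 2^n ℤ`, while the column form is the mean-square correlation
  `Σ_{c,c'} |Σ_{r<2^n} λ(2^n r + c + 1) λ(2^n r + c' + 1)|²` of `λ` along PAIRS OF RESIDUE CLASSES modulo `2^n = √X` —
  the same number.

Honest framing: an identity; `stub_twoPointDigital`, `DigitalBilinearLiouville`, `LiouvilleCutRank`, `AlgebraicSarnak`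
stay OPEN and nothing here bears on `VP ≠ VNP`.  No definitions.
-/

-- the directory `ValiantsHypothesis/ValiantsHypothesis` repeats the summit name (tree layout)
set_option linter.dupNamespace false

namespace Summit.ValiantsHypothesis.ValiantsHypothesis.Theorems.LiouvilleSarnakDigitalBilinearLiouville.TtStarGramSymmetry

open Finset ArithmeticFunction

/-! ### §1 The four-fold sum, summed two ways -/

/-- **Row Gram sum = column Gram sum** for any integer matrix: `Σ_{r,r'} (Σ_c B_rc B_r'c)² = Σ_{c,c'} (Σ_r B_rc B_rc')²`
(expand both squares into the four-fold sum `Σ B_rc B_r'c B_rc' B_r'c'` and exchange the order of summation).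
[folklore] -/
theorem gram_rows_eq_gram_cols {ι κ : Type*} [Fintype ι] [Fintype κ] (B : ι → κ → ℤ) :
    ∑ r, ∑ r', (∑ c, B r c * B r' c) ^ 2 = ∑ c, ∑ c', (∑ r, B r c * B r c') ^ 2 := by
  have h1 : ∀ r r', (∑ c, B r c * B r' c) ^ 2 = ∑ c, ∑ c', (B r c * B r' c) * (B r c' * B r' c') := by
    intro r r'
    rw [sq, Finset.sum_mul_sum]
  have h2 : ∀ c c', (∑ r, B r c * B r c') ^ 2 = ∑ r, ∑ r', (B r c * B r' c) * (B r c' * B r' c') := by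
    intro c c'
    rw [sq, Finset.sum_mul_sum]
    exact Finset.sum_congr rfl fun r _ => Finset.sum_congr rfl fun r' _ => by ring
  simp_rw [h1, h2]
  -- `Σ_r Σ_r' Σ_c Σ_c' F = Σ_c Σ_c' Σ_r Σ_r' F`
  calc ∑ r, ∑ r', ∑ c, ∑ c', B r c * B r' c * (B r c' * B r' c')
      = ∑ r, ∑ c, ∑ r', ∑ c', B r c * B r' c * (B r c' * B r' c') :=
        Finset.sum_congr rfl fun r _ => Finset.sum_comm
    _ = ∑ r, ∑ c, ∑ c', ∑ r', B r c * B r' c * (B r c' * B r' c') :=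
        Finset.sum_congr rfl fun r _ => Finset.sum_congr rfl fun c _ => Finset.sum_comm
    _ = ∑ c, ∑ r, ∑ c', ∑ r', B r c * B r' c * (B r c' * B r' c') := Finset.sum_comm
    _ = ∑ c, ∑ c', ∑ r, ∑ r', B r c * B r' c * (B r c' * B r' c') :=
        Finset.sum_congr rfl fun c _ => Finset.sum_comm

/-! ### §2 The Liouville cut matrix -/

/-- ★ **Row-pair form = column-pair form of the `tt_star` correlation sum**, for EVERY cut `π` at EVERY level `n`:
`Σ_{r,r'} ‖Σ_c λ(N_π(r,c)+1) λ(N_π(r',c)+1)‖² = Σ_{c,c'} ‖Σ_r λ(N_π(r,c)+1) λ(N_π(r,c')+1)‖²`. [folklore] -/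
theorem twoPoint_rows_eq_cols (n : ℕ) (π : Fin n ⊕ Fin n ≃ Fin (2 * n)) :
    (∑ r : Fin n → Bool, ∑ r' : Fin n → Bool,
        ‖∑ c : Fin n → Bool,
          ((liouville (Nat.ofBits (fun j : Fin (2 * n) => Sum.elim r c (π.symm j)) + 1) : ℤ) : ℂ) *
          ((liouville (Nat.ofBits (fun j : Fin (2 * n) => Sum.elim r' c (π.symm j)) + 1) : ℤ) : ℂ)‖ ^ 2) =
    (∑ c : Fin n → Bool, ∑ c' : Fin n → Bool,
        ‖∑ r : Fin n → Bool,
          ((liouville (Nat.ofBits (fun j : Fin (2 * n) => Sum.elim r c (π.symm j)) + 1) : ℤ) : ℂ) *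
          ((liouville (Nat.ofBits (fun j : Fin (2 * n) => Sum.elim r c' (π.symm j)) + 1) : ℤ) : ℂ)‖ ^ 2) := by
  set B : (Fin n → Bool) → (Fin n → Bool) → ℤ := fun r c =>
    liouville (Nat.ofBits (fun j : Fin (2 * n) => Sum.elim r c (π.symm j)) + 1) with hB
  have key := gram_rows_eq_gram_cols B
  -- cast the integer identity to `ℝ` through `‖(z : ℂ)‖² = z²`
  have hrow : ∀ r r' : Fin n → Bool,
      ‖∑ c : Fin n → Bool, ((B r c : ℤ) : ℂ) * ((B r' c : ℤ) : ℂ)‖ ^ 2 = (((∑ c, B r c * B r' c) ^ 2 : ℤ) : ℝ) := by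
    intro r r'
    have hc : (∑ c : Fin n → Bool, ((B r c : ℤ) : ℂ) * ((B r' c : ℤ) : ℂ)) = (((∑ c, B r c * B r' c : ℤ)) : ℂ) := by
      push_cast; rfl
    rw [hc, Complex.norm_intCast, sq_abs]
    push_cast; ring
  have hcol : ∀ c c' : Fin n → Bool,
      ‖∑ r : Fin n → Bool, ((B r c : ℤ) : ℂ) * ((B r c' : ℤ) : ℂ)‖ ^ 2 = (((∑ r, B r c * B r c') ^ 2 : ℤ) : ℝ) := by
    intro c c'
    have hc : (∑ r : Fin n → Bool, ((B r c : ℤ) : ℂ) * ((B r c' : ℤ) : ℂ)) = (((∑ r, B r c * B r c' : ℤ)) : ℂ) := by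
      push_cast; rfl
    rw [hc, Complex.norm_intCast, sq_abs]
    push_cast; ring
  have key' : (((∑ r, ∑ r', (∑ c, B r c * B r' c) ^ 2 : ℤ)) : ℝ) = (((∑ c, ∑ c', (∑ r, B r c * B r c') ^ 2 : ℤ)) : ℝ) := by
    rw [key]
  have lhs : (∑ r : Fin n → Bool, ∑ r' : Fin n → Bool,
      ‖∑ c : Fin n → Bool, ((B r c : ℤ) : ℂ) * ((B r' c : ℤ) : ℂ)‖ ^ 2) =
      (((∑ r, ∑ r', (∑ c, B r c * B r' c) ^ 2 : ℤ)) : ℝ) := by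
    push_cast
    refine Finset.sum_congr rfl fun r _ => Finset.sum_congr rfl fun r' _ => ?_
    rw [hrow]; push_cast; ring
  have rhs : (∑ c : Fin n → Bool, ∑ c' : Fin n → Bool,
      ‖∑ r : Fin n → Bool, ((B r c : ℤ) : ℂ) * ((B r c' : ℤ) : ℂ)‖ ^ 2) =
      (((∑ c, ∑ c', (∑ r, B r c * B r c') ^ 2 : ℤ)) : ℝ) := by
    push_cast
    refine Finset.sum_congr rfl fun c _ => Finset.sum_congr rfl fun c' _ => ?_
    rw [hcol]; push_cast; ring
  have : (∑ r : Fin n → Bool, ∑ r' : Fin n → Bool,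
      ‖∑ c : Fin n → Bool, ((B r c : ℤ) : ℂ) * ((B r' c : ℤ) : ℂ)‖ ^ 2) =
      (∑ c : Fin n → Bool, ∑ c' : Fin n → Bool,
      ‖∑ r : Fin n → Bool, ((B r c : ℤ) : ℂ) * ((B r c' : ℤ) : ℂ)‖ ^ 2) := by
    rw [lhs, rhs, key']
  simpa only [hB] using this

/-- **`stub_twoPointDigital` in column currency.**  The registered open stub of line `tt_star` (row pairs) is
equivalent to the same statement over column pairs, level by level and cut by cut. [folklore] -/
theorem twoPointDigital_iff_cols :
    (∀ ε : ℝ, 0 < ε → ∃ n₀ : ℕ, ∀ n ≥ n₀, ∀ π : Fin n ⊕ Fin n ≃ Fin (2 * n),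
      (∑ r : Fin n → Bool, ∑ r' : Fin n → Bool,
        ‖∑ c : Fin n → Bool,
          ((liouville (Nat.ofBits (fun j : Fin (2 * n) => Sum.elim r c (π.symm j)) + 1) : ℤ) : ℂ) *
          ((liouville (Nat.ofBits (fun j : Fin (2 * n) => Sum.elim r' c (π.symm j)) + 1) : ℤ) : ℂ)‖ ^ 2) ≤
      ε * 16 ^ n) ↔
    (∀ ε : ℝ, 0 < ε → ∃ n₀ : ℕ, ∀ n ≥ n₀, ∀ π : Fin n ⊕ Fin n ≃ Fin (2 * n),
      (∑ c : Fin n → Bool, ∑ c' : Fin n → Bool,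
        ‖∑ r : Fin n → Bool,
          ((liouville (Nat.ofBits (fun j : Fin (2 * n) => Sum.elim r c (π.symm j)) + 1) : ℤ) : ℂ) *
          ((liouville (Nat.ofBits (fun j : Fin (2 * n) => Sum.elim r c' (π.symm j)) + 1) : ℤ) : ℂ)‖ ^ 2) ≤
      ε * 16 ^ n) := by
  constructor
  · intro h ε hε
    obtain ⟨n₀, hn₀⟩ := h ε hε
    exact ⟨n₀, fun n hn π => by rw [← twoPoint_rows_eq_cols]; exact hn₀ n hn π⟩
  · intro h ε hε
    obtain ⟨n₀, hn₀⟩ := h ε hε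
    exact ⟨n₀, fun n hn π => by rw [twoPoint_rows_eq_cols]; exact hn₀ n hn π⟩

end Summit.ValiantsHypothesis.ValiantsHypothesis.Theorems.LiouvilleSarnakDigitalBilinearLiouville.TtStarGramSymmetry
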